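import Summits.HubbardSuperconductivity.HubbardSuperconductivity.Theses.DeformationLadder
import Summits.HubbardSuperconductivity.HubbardSuperconductivity.Theorems.TwistGapTgTwistCeiling
import Summits.HubbardSuperconductivity.HubbardSuperconductivity.Theorems.DeformationLadderLowEnergyRigidityKernelStates
import Literature.Barriers.HubbardSuperconductivity.PureModelStripeCompetitionProofs
import Literature.MathematicalPhysics.QuantumLattice.FreeFermiGasNoPairFieldLRO
import Literature.MathematicalPhysics.QuantumLattice.LTQOProofs
import Literature.Computability.AlgebraicComplexity.SubspaceProjection
import Literature.MathematicalPhysics.QuantumLattice.HubbardGrandCanonicalDensity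
import Summits.HubbardSuperconductivity.HubbardSuperconductivity.Theorems.BalabanIRBirEveryGroundStateSchur
import Summits.HubbardSuperconductivity.HubbardSuperconductivity.Theorems.SsbToEvenTorusLro.Negative.SaturatedFerromagnet

/-!
# Disproof of `LowEnergyRigidity` (stmt-HubbardSuperconductivity-1892) — findings

Work file of the crux DISPROVER (refuter, cdisprove mode) for the rank-2 corner crux of route
`DeformationLadder`:

`LowEnergyRigidity := ∃ U>0, δ∈(0,½), κ>0, a>0, L₀, ∀ even L ≥ L₀, ∀ unit φ ∈ szSector N_L 0,
  Re⟨φ, H_L φ⟩ ≤ minEnergyOn H_L (szSector N_L 0) + κ → a ≤ L⁻⁴ Re⟨φ, Δ_dᴴΔ_d φ⟩`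
(`H_L = hubbardTorus 2 L 1 U`, `N_L = 2⌊(1-δ)L²/2⌋`, `Δ_d = pairField dWaveFormFactor L`).

## Verdict of this cycle: NO KILL — the crux is the open physics, not a formal artefact
* The statement elaborates (rc 0); all carriers are honest (`minEnergyOn` = `sInf` over UNIT
  sector vectors, junk only on `⊥`, and the sector is nonempty for `L ≥ 2`; `expect A ψ = ⟨ψ, Aψ⟩`;
  no `ℕ`-subtraction, no `0⁻¹`, no `Finset.sup ∅`).
* `¬LowEnergyRigidity` = "at EVERY `(U,δ) ∈ (0,∞)×(0,½)` and every O(1) window `κ`, low-energy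
  sector states with d-wave LRO density `→ 0` exist along even `L`" — this contains the absence of
  phase-rigid d-wave superconductivity in the whole repulsive phase diagram, as open as the summit
  (in-tree iffs: `LowEnergyRigidity ↔ LadderThesis ↔ TwistGap.TgThesis`, Theorems
  `…LadderThesisRigidityReduction`, `…NormalForms`).  No finite computation reaches it (`∃ L₀`).

## What IS proved here (all sorry-free). LANDED inline-statement copies (all ACCEPTED, std axioms):
##   `Theorems/LowEnergyRigidity/Negative/WindowMustBeBounded.lean`          p119445 (commit 74f68c4dacbb)
##   `Theorems/LowEnergyRigidity/Negative/FalseWithoutRepulsion.lean`        p119672 (commit 4cd6c903c899)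
##   `Theorems/LowEnergyRigidity/Negative/NoUniformFloorNearZeroCoupling.lean` p120267 (commit 4039521127e4)
##   `Theorems/LowEnergyRigidity/Negative/FerromagnetExclusion.lean`         p120201 (commit cbcacffbb7a7)
(a) LOAD-BEARING ANALYSIS
  * `lowEnergyRigidity_iff_with` — the crux by name is `∃ κ>0 a>0, LowEnergyRigidityWith κ a`
    (parametrised rigidity matrix `RigidAt U δ κ a L`), so every lemma below is about the crux's
    own matrix.
  * `lowEnergyRigidity_false_without_window` — drop the energy window (`κ = +∞`): FALSE at every
    `(U,δ)`. Witness: the explicit unit KERNEL state of `Δ_d` in `szSector N_L 0` (row-separated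
    `↑`/`↓` blocks, `hcf_exists_unit_kernel_state`, crux idea heavy-condensate-fibration), LRO `= 0`.
    ⇒ any proof must use the window; the kinematic kernel of the order parameter meets the sector.
  * `not_lowEnergyRigidityWindow_of_unbounded` / `_of_tendsto` / `_pow` — replace the O(1) window
    `κ` by ANY window `w L` unbounded along even `L` (e.g. `κ·L^α`, `α > 0`, in particular an
    extensive window `κL²` = positive energy DENSITY): FALSE at every `(U,δ)`, superconducting or
    not. Mechanism: Lieb–Schultz–Mattis charge twists × Parseval (the provers' twist ceiling
    `rigidity_scale_le_twistCeiling`: rigidity `(κ,a)` at one large side forces `a³κ ≤ 64C³`,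
    `C = 32π²+32`). ⇒ the exponent `0` in `κ·L⁰` is SHARP; any proof must use that the window is
    `O(1)` — energy-density (thermal-like) arguments cannot reach the crux, and conversely the crux
    cannot be strengthened towards "finite energy density" (consistent with no LRO at `T>0`).
  * `lowEnergyRigidity_false_without_repulsion` — weaken `0 < U` to `0 ≤ U`: at `U = 0` the matrix
    is FALSE for every `δ > -1`, every window `κ ≥ 0`, every order `a > 0`: the free torus has in
    every sector a unit GROUND state with `Re⟨Δ_dᴴΔ_d⟩ ≤ 32L²` (tree's selection rule
    `re_trace_sectorEigenProj_mul_pairField_dWave_le_free` — occupation-diagonal weights carry no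
    pair LRO, open shells included — plus an orthonormal-frame pigeonhole
    `exists_unit_mem_re_rayleigh_le_of_trace_le`), and a ground state sits in every window.
    ⇒ any proof must use the repulsion `U > 0` essentially; a witness order `a(U)` cannot stay
    bounded below through `U = 0` (p119672, `Negative/FalseWithoutRepulsion.lean`).
(b) TIGHTNESS
  * `not_lowEnergyRigidityWith_of_large_order` — for a prescribed pair `(κ,a)` with
    `a³κ > 64(32π²+32)³` the crux matrix is FALSE at every `(U,δ)`: the admissible region is
    `a ≤ 4C·κ^{-1/3}` (and trivially `a ≤ 32`). Quantitative form of the refuters' first test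
    "one-flux twist: `κ < c·ρ_s`" recorded on the item (route-review 2026-08-15).
(c) NATURAL STRENGTHENINGS refuted: growing windows (a); over-ordered `(κ,a)` (b); `U = 0` / the
    closed coupling range `0 ≤ U` (a); and
  * `not_lowEnergyRigidity_uniform_near_zero_coupling` — NO `(δ, κ, a, L₀, U₀)` makes the matrix hold
    for every `U ∈ (0, U₀)` at every even `L ≥ L₀`: fix an even `L` with `aL² > 32`, the pair-poor
    free ground state `φ` there, and `U = min(U₀/2, κ/L²)`; since `H_U = H_0 + UΣ_x n_{x↑}n_{x↓}`
    with `0 ≤ Σ_x n_{x↑}n_{x↓} ≤ L²`, `Re⟨φ,H_Uφ⟩ ≤ E₀(0) + UL² ≤ E₀(U) + κ` — the FREE ground state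
    sits in the `κ`-window of the INTERACTING model — with LRO `≤ 32/L² < a`. ⇒ in any witness the
    triple `(κ, a, L₀)(U)` degenerates as `U → 0⁺`; quantitatively `L₀(U)² > κ(U)/U` is forced
    whenever `a(U)` stays above `32/L₀(U)²` (Negative copy: `NoUniformFloorNearZeroCoupling.lean`, p120267).

## Attacks that do NOT kill (recorded so nobody repeats them)
1. One-flux gauge twist `W = exp(2πi Σ_x x₁ n_{x↑}/L)`: sector-preserving, unit, energy
   `E₀ + ⟨P_θ⟩ ≤ E₀ + 16π²`, zero-mode LRO of `Wψ₀` = pair weight of `ψ₀` at momentum `±e₁`.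
   Kills only `κ ≥ 16π²`-type windows (provers' `lowEnergyRigidity_ceiling`, PinnedFrameBloch) and,
   iterated over `J` twists with Parseval, gives (b). For SMALL `κ` nothing: `∃κ` absorbs it.
2. Smooth phase modulation `exp(iA Σ_x sin(2πx₁/L) n_x)ψ₀`: LRO factor `J₀(2A)²`, cost `≈ π²ρ_s A²`;
   first zero of `J₀` at `2A = 2.405` costs `≈ 14.3 ρ_s` < one-flux cost `2π²ρ_s ≈ 19.7ρ_s`, but for
   a window `κ ≪ ρ_s` the LRO only drops by the factor `1 - O(κ/ρ_s)`: no kill, `a ≈ m²(1-cκ/ρ_s)`.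
3. Superpositions `αψ₀ + βWψ₀` (different momentum sectors ⇒ no cross terms): LRO
   `(1-|β|²)m²`, energy `E₀ + |β|²·cost`: convex interpolation only, no kill.
4. Vortex pairs / finite competing domains: O(1) energy, LRO change `o(1)`. Nodal quasiparticles:
   `κL` of them cost O(1) only if each costs `O(1/L)`; LRO change `O(1/L)`. Amplitude suppression on
   a fraction `θ` of the volume costs `θ ε_cond L²` (extensive at fixed `U`): no kill at fixed `(U,δ)`.
5. Kernel states of `Δ_d` (LRO exactly `0`) are occupation basis states: energy EXACTLY `0`
   (no double occupancy, hopping off-diagonal) while `E₀ ≈ -c(U,δ)L² < 0`: far outside every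
   O(1) window. Mixing `√(1-t)ψ₀ + √t χ_ker` costs `t|E₀| ∼ tL²`: kills only extensive windows.
6. Small-`L` exact diagonalisation is USELESS against `∃ L₀` (and `∃ U δ κ a` over reals).
7. Junk models: `U = 0` is excluded by `0 < U` — and rightly so: there the matrix is FALSE
   (`lowEnergyRigidity_false_without_repulsion`, proved below WITHOUT any approximating-Hamiltonian
   input: a pair-poor free ground state exists in every sector); `δ ∈ (0,½)` excludes half filling
   and the empty band (at `δ = 1` the sector is the vacuum line and the matrix is trivially false).
8. Literature: no theorem excludes d-wave ODLRO of low-energy states of the 2D repulsive Hubbard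
   model at any `(U,δ)` with `δ ∈ (0,½)` at `T = 0` (barrier catalogue
   `Literature/Barriers/HubbardSuperconductivity/`: HohenbergMerminWagnerPairing and
   PositiveTemperatureNoPairLRO are `T>0`; GeneralizedHartreeFockNoPairing is about quasi-free
   states; WeakCouplingCeiling / PerturbativeInvisibilityOfPairing bound SIZES (`a ≲ e^{-c/U}`-type
   heuristics, rigorous `a ≤ 64√2·√U` per prover OCC's evidence file), never give `a = 0`;
   PureModelStripeCompetition is numerics (QinEtAl2020) at `U ≈ 8, δ ≈ 1/8`, not a theorem and not
   uniform in `(U,δ)`).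

## (d) A SECOND KERNEL FAMILY WITH A PHYSICAL ENERGY: saturated ferromagnets (formalised)
9. `rigidAt_false_of_ferromagnet_in_window` / `not_completable_of_frequently_ferromagnet`:
   the singlet pair field commutes with total spin and lowers `N` by `2`, so it ANNIHILATES every
   state of maximal total spin (`NoGo.pairField_mulVec_eq_zero_of_saturated`, Tasaki 1998 p. 20);
   the `(S⁻)ⁿ`-descendant of a ground state of the fully polarised sector `(N_L, S^z = N_L/2)` (a
   free spinless band, blind to `U`) is a unit `H`-eigenvector of `szSector N_L 0` with the
   ferromagnetic energy `E_FM(L) = E_min(N_L, N_L/2)` and LRO exactly `0`. Hence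
   `E_FM(L) ≤ E₀(L) + κ` at infinitely many even `L` kills every witness at `(U, δ, κ)`: a witness
   CERTIFIES `E_FM > E₀ + κ` eventually — the chosen `(U, δ)` lies outside every Nagaoka-type corner
   in this quantitative sense (open at positive hole density for all finite `U`, Tasaki 1998 §4.4;
   excluded at small `U` on finite lattices, ibid. Thm 3.2). Negative copy p120201 ACCEPTED
   (`Negative/FerromagnetExclusion.lean`). Not a refutation.

## WHY IT RESISTS (for the provers) — and what every proof must reproduce
Refuting needs, at EVERY `(U,δ)`, window states BELOW the twist scale with vanishing zero-mode
pair weight — i.e. control of the pure ground state's pair-momentum distribution (is the `q = 0`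
weight `o(1)` or not?). That is the summit's open content itself. The landed constraints on a
witness `(U, δ, κ, a, L₀)`: (i) the window is an `O(L⁰)` quantity — no energy-density input
suffices (a); (ii) `a³κ ≤ 64(32π²+32)³`, `a ≤ 32` (b); (iii) `U > 0` is used essentially, and
`(κ, a, L₀)(U)` degenerates as `U → 0⁺` with `L₀(U)² ≳ κ/U` (a, c) — consistent with
`L₀ ≳ ξ_BCS`, `a ∼ Δ²`; (iv) the saturated ferromagnet stays `> κ` above the sector ground energy at
all large even `L` (d). Sharper but unlanded: `a ≤ 64√2·√U` (prover OCC).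

## NEAR-MISSES (not closed here; no sorries kept in this file)
* The SHARPER weak-coupling order ceiling `a ≤ 64√2·√U` for every witness (prover OCC-358885bb,
  evidence files `DeformationLadderLowEnergyRigidityOrderCeiling*.lean` on the item, rc0 but
  UNLANDED — blocked on permissions, not on mathematics; ingredients in tree: `stub_t0AHM`,
  `energySandwich_proof`, GSEE master bounds `TwPureThermalBoundGseeMaster`). Not redone here: the
  elementary `not_lowEnergyRigidity_uniform_near_zero_coupling` below already kills the `U`-uniform
  floor (with `L₀` uniform); OCC's bound additionally kills it with `L₀ = L₀(U)` free.
* A `δ`-uniform or `L₀`-uniform-in-`δ` strengthening: no handle found (half filling `δ → 0⁺` is as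
  open as the rest).
-/

set_option linter.dupNamespace false

namespace Summit.HubbardSuperconductivity.HubbardSuperconductivity.Cruxes.LowEnergyRigidity.Disproof

open Literature.MathematicalPhysics.QuantumLattice Matrix Filter Literature.Barriers.HubbardSuperconductivity
open scoped ComplexOrder
open Summit.HubbardSuperconductivity.HubbardSuperconductivity.Theses.DeformationLadder
open Summit.HubbardSuperconductivity.HubbardSuperconductivity.Theorems
open Summit.HubbardSuperconductivity.HubbardSuperconductivity.Theorems.DeformationLadder

noncomputable section

/-! ### The parametrised rigidity matrix -/

/-- The rigidity matrix of the crux at one side `L` with data `(U, δ, κ, a)`: every unit vector of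
`szSector N_L 0` within energy `κ` of the sector ground energy of `hubbardTorus 2 L 1 U` has
`d`-wave LRO density `≥ a`. (Literally the body of `LowEnergyRigidity` after its quantifiers.) -/
def RigidAt (U δ κ a : ℝ) (L : ℕ) [NeZero L] : Prop :=
  ∀ φ : Fock (Orb (FermionTorus 2 L)),
    φ ∈ szSector (Λ := FermionTorus 2 L) (2 * ⌊(1 - δ) * (L : ℝ) ^ 2 / 2⌋₊) 0 →
    star φ ⬝ᵥ φ = 1 →
    (star φ ⬝ᵥ Matrix.mulVec (hubbardTorus 2 L 1 U) φ).re ≤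
      (hubbardTorus 2 L 1 U).minEnergyOn
        (szSector (Λ := FermionTorus 2 L) (2 * ⌊(1 - δ) * (L : ℝ) ^ 2 / 2⌋₊) 0) + κ →
    a ≤ (expect ((pairField dWaveFormFactor L)ᴴ * pairField dWaveFormFactor L) φ).re / (L : ℝ) ^ 4

/-- The crux with the pair `(κ, a)` prescribed: `∃ U>0, δ∈(0,½), L₀, ∀ even L ≥ L₀, RigidAt`. -/
def LowEnergyRigidityWith (κ a : ℝ) : Prop :=
  ∃ U : ℝ, 0 < U ∧ ∃ δ ∈ Set.Ioo (0 : ℝ) (1 / 2), ∃ L₀ : ℕ, ∀ (L : ℕ) [NeZero L], L₀ ≤ L →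
    Even L → RigidAt U δ κ a L

/-- The crux with the O(1) window `κ` replaced by a side-dependent window `w L`. -/
def LowEnergyRigidityWindow (w : ℕ → ℝ) : Prop :=
  ∃ U : ℝ, 0 < U ∧ ∃ δ ∈ Set.Ioo (0 : ℝ) (1 / 2), ∃ a : ℝ, 0 < a ∧ ∃ L₀ : ℕ,
    ∀ (L : ℕ) [NeZero L], L₀ ≤ L → Even L → RigidAt U δ (w L) a L

/-- The crux with the energy window DROPPED: every unit sector vector has LRO density `≥ a`. -/
def LowEnergyRigidityWithoutWindow : Prop :=
  ∃ U : ℝ, 0 < U ∧ ∃ δ ∈ Set.Ioo (0 : ℝ) (1 / 2), ∃ a : ℝ, 0 < a ∧ ∃ L₀ : ℕ,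
    ∀ (L : ℕ) [NeZero L], L₀ ≤ L → Even L → ∀ φ : Fock (Orb (FermionTorus 2 L)),
      φ ∈ szSector (Λ := FermionTorus 2 L) (2 * ⌊(1 - δ) * (L : ℝ) ^ 2 / 2⌋₊) 0 →
      star φ ⬝ᵥ φ = 1 →
      a ≤ (expect ((pairField dWaveFormFactor L)ᴴ * pairField dWaveFormFactor L) φ).re / (L : ℝ) ^ 4

/-- **Normal form.** The crux BY NAME is the `(κ, a)`-parametrised matrix with `∃ κ>0, ∃ a>0` in
front (pure quantifier shuffling). -/
theorem lowEnergyRigidity_iff_with :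
    LowEnergyRigidity ↔ ∃ κ : ℝ, 0 < κ ∧ ∃ a : ℝ, 0 < a ∧ LowEnergyRigidityWith κ a := by
  constructor
  · rintro ⟨U, hU, δ, hδ, κ, hκ, a, ha, L₀, h⟩
    exact ⟨κ, hκ, a, ha, U, hU, δ, hδ, L₀, fun L _ hL hev => h L hL hev⟩
  · rintro ⟨κ, hκ, a, ha, U, hU, δ, hδ, L₀, h⟩
    exact ⟨U, hU, δ, hδ, κ, hκ, a, ha, L₀, fun L _ hL hev => h L hL hev⟩

/-- The crux is the constant-window case of `LowEnergyRigidityWindow`. -/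
theorem lowEnergyRigidity_iff_window_const :
    LowEnergyRigidity ↔ ∃ κ : ℝ, 0 < κ ∧ LowEnergyRigidityWindow (fun _ => κ) := by
  constructor
  · rintro ⟨U, hU, δ, hδ, κ, hκ, a, ha, L₀, h⟩
    exact ⟨κ, hκ, U, hU, δ, hδ, a, ha, L₀, fun L _ hL hev => h L hL hev⟩
  · rintro ⟨κ, hκ, U, hU, δ, hδ, a, ha, L₀, h⟩
    exact ⟨U, hU, δ, hδ, κ, hκ, a, ha, L₀, fun L _ hL hev => h L hL hev⟩

/-- Window monotonicity: a larger window is a stronger requirement. -/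
theorem RigidAt.mono {U δ κ κ' a : ℝ} {L : ℕ} [NeZero L] (h : RigidAt U δ κ a L) (hκ : κ' ≤ κ) :
    RigidAt U δ κ' a L :=
  fun φ hφ hφ1 hE => h φ hφ hφ1 (hE.trans (by linarith))

/-! ### (b) Tightness: the admissible `(κ, a)` region is `a³ κ ≤ 64 (32π² + 32)³` -/

/-- **One side suffices.** If the rigidity matrix holds at ONE side `L ≥ 2⌈(κ/64)^{1/3}⌉₊ + 1`
with `κ > 0` and `δ ≥ -1`, then `a³ κ ≤ 64·(32π²+32)³` (cube of the provers' twist ceiling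
`rigidity_scale_le_twistCeiling`: `a·(κ/64) ≤ C (κ/64)^{2/3}`). -/
theorem cube_order_mul_window_le_of_rigidAt {U δ κ a : ℝ} (hκ : 0 < κ) (hδ : -1 ≤ δ) {L : ℕ}
    [NeZero L] (hL : 2 * ⌈(κ / 64) ^ (1 / 3 : ℝ)⌉₊ + 1 ≤ L) (h : RigidAt U δ κ a L) :
    a ^ 3 * κ ≤ 64 * (32 * Real.pi ^ 2 + 32) ^ 3 := by
  have hs : 0 < κ / 64 := by positivity
  have hmain := rigidity_scale_le_twistCeiling U δ hκ L hL (natFloor_filling_le_sq hδ L) h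
  set C : ℝ := 32 * Real.pi ^ 2 + 32 with hC
  set s : ℝ := κ / 64 with hs_def
  have hC0 : 0 ≤ C := by positivity
  by_cases ha0 : a ≤ 0
  · have h1 : a ^ 3 * κ ≤ 0 := by
      have : a ^ 3 ≤ 0 := by
        have := pow_le_pow_left₀ (neg_nonneg.2 ha0) (le_refl (-a)) 3
        nlinarith [Odd.pow_nonpos (by decide : Odd 3) ha0]
      nlinarith
    have h2 : (0 : ℝ) ≤ 64 * C ^ 3 := by positivity
    linarith
  push Not at ha0
  -- cube `a s ≤ C s^{2/3}` and cancel `s²`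
  have h3 := pow_le_pow_left₀ (mul_nonneg ha0.le hs.le) hmain 3
  have hs2 : (s ^ (2 / 3 : ℝ)) ^ 3 = s ^ 2 := by
    rw [← Real.rpow_natCast, ← Real.rpow_mul hs.le]; norm_num
  rw [mul_pow, mul_pow, hs2] at h3
  have hs3 : 0 < s ^ 2 := by positivity
  have h4 : a ^ 3 * s ≤ C ^ 3 := by
    have h5 : a ^ 3 * s * s ^ 2 ≤ C ^ 3 * s ^ 2 := by nlinarith [h3]
    exact le_of_mul_le_mul_right h5 hs3
  have : a ^ 3 * κ = 64 * (a ^ 3 * s) := by rw [hs_def]; ring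
  rw [this]
  nlinarith [h4]

/-- **Tightness of the corner crux (refutation of the over-ordered strengthening).** For every
prescribed pair `(κ, a)` with `a³ κ > 64·(32π² + 32)³` the crux matrix fails at EVERY
`(U, δ) ∈ (0,∞) × (0,½)` and every `L₀`: `¬ LowEnergyRigidityWith κ a`. Any witness of
`LowEnergyRigidity` lives in `a ≤ 4(32π²+32)·κ^{-1/3}` — the quantitative "`κ` below the twist
(stiffness) scale" constraint. Lieb–Schultz–Mattis (1961) App. B via the provers' twist ceiling. -/
theorem not_lowEnergyRigidityWith_of_large_order {κ a : ℝ} (hκ : 0 < κ)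
    (hlarge : 64 * (32 * Real.pi ^ 2 + 32) ^ 3 < a ^ 3 * κ) : ¬ LowEnergyRigidityWith κ a := by
  rintro ⟨U, -, δ, hδ, L₀, h⟩
  -- an even side beyond `L₀` and beyond the twist-number threshold
  set L₁ : ℕ := 2 * ⌈(κ / 64) ^ (1 / 3 : ℝ)⌉₊ + 1 with hL₁
  set L : ℕ := 2 * (max L₀ L₁ + 1) with hLdef
  have hLpos : 0 < L := by rw [hLdef]; omega
  haveI : NeZero L := ⟨hLpos.ne'⟩
  have hL0 : L₀ ≤ L := by
    have := le_max_left L₀ L₁; rw [hLdef]; omega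
  have hL1 : L₁ ≤ L := by
    have := le_max_right L₀ L₁; rw [hLdef]; omega
  have hev : Even L := ⟨max L₀ L₁ + 1, by rw [hLdef]; ring⟩
  have hrig := h L hL0 hev
  have := cube_order_mul_window_le_of_rigidAt hκ (by linarith [hδ.1]) (hL₁ ▸ hL1) hrig
  linarith

/-! ### (a) Load-bearing analysis I: the window must be `O(1)` — unbounded windows are refuted -/

/-- **Unbounded windows kill rigidity at every `(U,δ)`.** If the window `w L` is unbounded along
the even sides (`∀ M L₀, ∃ even L ≥ L₀, w L ≥ M`), then `¬ LowEnergyRigidityWindow w`: at a side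
where `w L ≥ M := 64((C+1)/a)³` the matrix with window `M` holds a fortiori (`RigidAt.mono`), and
the one-side twist ceiling gives `a·(M/64) ≤ C (M/64)^{2/3}`, i.e. `C + 1 ≤ C`. In particular the
exponent `0` of the crux's window `κ·L⁰` cannot be raised. -/
theorem not_lowEnergyRigidityWindow_of_unbounded (w : ℕ → ℝ)
    (hw : ∀ (M : ℝ) (L₀ : ℕ), ∃ L : ℕ, L₀ ≤ L ∧ Even L ∧ M ≤ w L) :
    ¬ LowEnergyRigidityWindow w := by
  rintro ⟨U, -, δ, hδ, a, ha, L₀, h⟩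
  set C : ℝ := 32 * Real.pi ^ 2 + 32 with hC
  have hC0 : 0 < C := by positivity
  set t : ℝ := (C + 1) / a with ht
  have ht0 : 0 < t := by positivity
  set M : ℝ := 64 * t ^ 3 with hM
  have hM0 : 0 < M := by positivity
  set L₁ : ℕ := 2 * ⌈(M / 64) ^ (1 / 3 : ℝ)⌉₊ + 1 with hL₁
  obtain ⟨L, hL, hev, hwL⟩ := hw M (max L₀ L₁ + 1)
  have hLpos : 0 < L := by omega
  haveI : NeZero L := ⟨hLpos.ne'⟩
  have hL0 : L₀ ≤ L := by have := le_max_left L₀ L₁; omega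
  have hL1 : L₁ ≤ L := by have := le_max_right L₀ L₁; omega
  have hrig : RigidAt U δ M a L := (h L hL0 hev).mono hwL
  have hmain := rigidity_scale_le_twistCeiling U δ hM0 L (hL₁ ▸ hL1)
    (natFloor_filling_le_sq (by linarith [hδ.1]) L) hrig
  -- `M/64 = t³`, `(t³)^{2/3} = t²`
  have h64 : M / 64 = t ^ 3 := by rw [hM]; ring
  have h23 : (t ^ 3) ^ (2 / 3 : ℝ) = t ^ 2 := by
    rw [← Real.rpow_natCast, ← Real.rpow_mul ht0.le]; norm_num
  rw [h64, h23] at hmain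
  -- `a t³ ≤ C t²` with `a t = C + 1`
  have hat : a * t = C + 1 := by rw [ht]; field_simp
  have ht2 : 0 < t ^ 2 := by positivity
  have : (C + 1) * t ^ 2 ≤ C * t ^ 2 := by
    calc (C + 1) * t ^ 2 = a * t ^ 3 := by rw [← hat]; ring
      _ ≤ C * t ^ 2 := hmain
  nlinarith

/-- Windows tending to `+∞` (along all sides) are unbounded along the even sides. -/
theorem not_lowEnergyRigidityWindow_of_tendsto (w : ℕ → ℝ) (hw : Tendsto w atTop atTop) :
    ¬ LowEnergyRigidityWindow w := by
  refine not_lowEnergyRigidityWindow_of_unbounded w fun M L₀ => ?_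
  obtain ⟨N, hN⟩ := eventually_atTop.1 (tendsto_atTop.1 hw M)
  refine ⟨2 * max N L₀, ?_, even_two_mul _, hN _ ?_⟩
  · have := le_max_right N L₀; omega
  · have := le_max_left N L₀; omega

/-- **Power windows.** For every `κ > 0` and every exponent `α > 0` the crux with window `κ·L^α`
is FALSE at every `(U,δ)`: `¬ LowEnergyRigidityWindow (fun L => κ * L^α)`. (`α = 2`: an
extensive window = positive excitation-energy DENSITY never forces d-wave LRO.) -/
theorem not_lowEnergyRigidityWindow_pow {κ α : ℝ} (hκ : 0 < κ) (hα : 0 < α) :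
    ¬ LowEnergyRigidityWindow (fun L => κ * (L : ℝ) ^ α) :=
  not_lowEnergyRigidityWindow_of_tendsto _
    (((tendsto_rpow_atTop hα).comp tendsto_natCast_atTop_atTop).const_mul_atTop hκ)

/-! ### (a) Load-bearing analysis II: without the window the matrix is false (kernel states) -/

/-- **The energy window is load-bearing (kinematically).** Dropping the window, the matrix is
FALSE at every `(U, δ)`: for even `L ≥ max(L₀, 2, 3/δ)` the explicit occupation-basis state with the
`↑` electrons on the first `⌊(1-δ)L²/2⌋` sites and the `↓` electrons two rows further
(`hcf_exists_unit_kernel_state`, crux idea heavy-condensate-fibration) is a unit vector of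
`szSector N_L 0` annihilated by `Δ_d`, so its LRO density is exactly `0 < a`. -/
theorem lowEnergyRigidity_false_without_window : ¬ LowEnergyRigidityWithoutWindow := by
  rintro ⟨U, -, δ, hδ, a, ha, L₀, h⟩
  -- an even side `L ≥ L₀` with `2 ≤ L` and `3 ≤ δ L`
  set L₁ : ℕ := ⌈3 / δ⌉₊ + 2 with hL₁
  set L : ℕ := 2 * (max L₀ L₁) with hLdef
  have hL1 : L₁ ≤ L := by have := le_max_right L₀ L₁; omega
  have hL0 : L₀ ≤ L := by have := le_max_left L₀ L₁; omega
  have hL2 : 2 ≤ L := by omega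
  haveI : NeZero L := ⟨by omega⟩
  have hev : Even L := even_two_mul _
  have hδL : 3 ≤ δ * L := by
    have h1 : 3 / δ ≤ (L₁ : ℝ) := by
      rw [hL₁]; push_cast; linarith [Nat.le_ceil (3 / δ)]
    have h2 : (L₁ : ℝ) ≤ L := by exact_mod_cast hL1
    have h3 : 3 / δ ≤ (L : ℝ) := h1.trans h2
    rw [div_le_iff₀ hδ.1] at h3
    linarith [mul_comm (L : ℝ) δ]
  set m : ℕ := ⌊(1 - δ) * (L : ℝ) ^ 2 / 2⌋₊ with hm
  have hmle : 2 * m + 3 * L ≤ L ^ 2 := by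
    have h1 : (m : ℝ) ≤ (1 - δ) * (L : ℝ) ^ 2 / 2 := by
      rw [hm]
      refine Nat.floor_le ?_
      have : 0 ≤ 1 - δ := by linarith [hδ.2]
      positivity
    have h2 : (2 * m + 3 * L : ℝ) ≤ (L : ℝ) ^ 2 := by nlinarith
    exact_mod_cast h2
  obtain ⟨φ, hφS, hφ1, hφ0⟩ := hcf_exists_unit_kernel_state L hL2 hmle
  have hLRO := h L hL0 hev φ hφS hφ1
  have hzero : expect ((pairField dWaveFormFactor L)ᴴ * pairField dWaveFormFactor L) φ = 0 := by
    simp only [Literature.MathematicalPhysics.QuantumLattice.expect]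
    rw [← mulVec_mulVec, hφ0, mulVec_zero, dotProduct_zero]
  rw [hzero, Complex.zero_re, zero_div] at hLRO
  exact absurd hLRO (not_le.2 ha)

/-- The same fact read as a window statement: `LowEnergyRigidityWithoutWindow` is implied by NO
window version, but implies every window version; recorded as the implication used by planners. -/
theorem lowEnergyRigidityWindow_of_withoutWindow (w : ℕ → ℝ) (h : LowEnergyRigidityWithoutWindow) :
    LowEnergyRigidityWindow w := by
  obtain ⟨U, hU, δ, hδ, a, ha, L₀, h⟩ := h
  exact ⟨U, hU, δ, hδ, a, ha, L₀, fun L _ hL hev φ hφ hφ1 _ => h L hL hev φ hφ hφ1⟩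

/-! ### (a) Load-bearing analysis III: the repulsion `0 < U` — at `U = 0` the matrix is false -/

section Pigeonhole

variable {m : Type*} [Fintype m] [DecidableEq m]

/-- **Some unit vector of `E` is at most as `Y`-rich as the `E`-average** (orthonormal-frame
pigeonhole; the `≤` twin of the BalabanIR closer `forall_ground_le_re_rayleigh_of_penalised_trace_le`):
`E ≠ ⊥`, `Re tr (P_E Y) ≤ c · Re tr P_E` ⇒ `∃` unit `φ ∈ E`, `Re⟨φ, Y φ⟩ ≤ c`. -/
theorem exists_unit_mem_re_rayleigh_le_of_trace_le (E : Submodule ℂ (m → ℂ)) (hE : E ≠ ⊥)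
    (Y : Matrix m m ℂ) (c : ℝ)
    (h : (projMatrix (E.map ((WithLp.linearEquiv 2 ℂ (m → ℂ)).symm :
        (m → ℂ) →ₗ[ℂ] EuclideanSpace ℂ m)) * Y).trace.re ≤
      c * (projMatrix (E.map ((WithLp.linearEquiv 2 ℂ (m → ℂ)).symm :
        (m → ℂ) →ₗ[ℂ] EuclideanSpace ℂ m))).trace.re) :
    ∃ φ ∈ E, star φ ⬝ᵥ φ = 1 ∧ (star φ ⬝ᵥ Y *ᵥ φ).re ≤ c := by
  obtain ⟨k, B, hk, hBB, hcol, hfix⟩ := Literature.Computability.AlgebraicComplexity.exists_orthonormalFrame E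
  have hP : projMatrix (E.map
      ((WithLp.linearEquiv 2 ℂ (m → ℂ)).symm : (m → ℂ) →ₗ[ℂ] EuclideanSpace ℂ m)) = B * Bᴴ :=
    Literature.Computability.AlgebraicComplexity.proj_unique (projMatrix_isHermitian _)
      (Matrix.isHermitian_mul_conjTranspose_self B)
      (fun _ hw => projMatrix_map_mulVec_of_mem E hw) (projMatrix_map_mulVec_mem E) hfix
      (Literature.Computability.AlgebraicComplexity.frame_proj_mulVec_mem hcol)
  have hdiag : ∀ j : Fin k,
      (Bᴴ * (Y * B)) j j = star (fun x => B x j) ⬝ᵥ Y *ᵥ (fun x => B x j) := by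
    intro j
    simp only [Matrix.mul_apply, Matrix.conjTranspose_apply, dotProduct, Matrix.mulVec,
      Pi.star_apply]
  have hunit : ∀ j : Fin k, star (fun x => B x j) ⬝ᵥ (fun x => B x j) = 1 := by
    intro j
    have := congrFun (congrFun hBB j) j
    simpa [Matrix.mul_apply, Matrix.conjTranspose_apply, dotProduct, Matrix.one_apply] using this
  have hkpos : 0 < k := by
    rw [hk]
    exact Submodule.one_le_finrank_iff.mpr hE
  rw [hP, Literature.Computability.AlgebraicComplexity.frame_proj_trace hBB, Matrix.mul_assoc,
    Matrix.trace_mul_comm, Matrix.mul_assoc, Matrix.trace] at h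
  simp only [Matrix.diag_apply, Complex.re_sum, Complex.natCast_re] at h
  have hsum : ∑ j : Fin k, ((Bᴴ * (Y * B)) j j).re ≤ ∑ _j : Fin k, c := by
    simpa [mul_comm] using h
  haveI : Nonempty (Fin k) := ⟨⟨0, hkpos⟩⟩
  obtain ⟨j, -, hj⟩ := Finset.exists_le_of_sum_le Finset.univ_nonempty hsum
  rw [hdiag] at hj
  exact ⟨fun x => B x j, hcol j, hunit j, hj⟩

end Pigeonhole

/-- **A pair-poor free ground state** (`U = 0`, `L ≥ 3`, `n ≤ L²`): the sector `(2n, S^z=0)` of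
the free torus contains a unit ground state `φ` with `Re⟨φ, Δ_dᴴΔ_d φ⟩ ≤ 32 L²` (selection rule
`re_trace_sectorEigenProj_mul_pairField_dWave_le_free` on the nontrivial ground eigenspace, plus
the pigeonhole). -/
theorem exists_unit_groundState_pairField_le_free (L : ℕ) [NeZero L] (hL : 3 ≤ L) {n : ℕ}
    (hn : n ≤ L ^ 2) :
    ∃ φ : Fock (Orb (FermionTorus 2 L)), φ ∈ szSector (Λ := FermionTorus 2 L) (2 * n) 0 ∧
      star φ ⬝ᵥ φ = 1 ∧
      hubbardTorus 2 L 1 0 *ᵥ φ =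
        (((hubbardTorus 2 L 1 0).minEnergyOn (szSector (Λ := FermionTorus 2 L) (2 * n) 0) : ℝ) : ℂ)
          • φ ∧
      (star φ ⬝ᵥ ((pairField dWaveFormFactor L)ᴴ * pairField dWaveFormFactor L) *ᵥ φ).re ≤
        32 * (L : ℝ) ^ 2 := by
  set H := hubbardTorus 2 L 1 0 with hH
  set S := szSector (Λ := FermionTorus 2 L) (2 * n) 0 with hS
  set e : ℂ := ((H.minEnergyOn S : ℝ) : ℂ) with he
  set E : Submodule ℂ (Fock (Orb (FermionTorus 2 L))) :=
    S ⊓ Module.End.eigenspace (Matrix.toLin' H) e with hEdef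
  have hE : E ≠ ⊥ := by
    obtain ⟨ψ, -, hψS, hψ0, hψeig⟩ := exists_unit_isGroundStateInSector_hubbardTorus 0 L n hn
    rw [Submodule.ne_bot_iff]
    refine ⟨ψ, ?_, hψ0⟩
    rw [hEdef, Submodule.mem_inf, Module.End.mem_eigenspace_iff, Matrix.toLin'_apply]
    exact ⟨hψS, hψeig⟩
  have hfree := re_trace_sectorEigenProj_mul_pairField_dWave_le_free (L := L) hL (2 * n) 0 e
  simp only at hfree
  obtain ⟨φ, hφE, hφ1, hφY⟩ := exists_unit_mem_re_rayleigh_le_of_trace_le E hE _ _ hfree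
  rw [hEdef, Submodule.mem_inf, Module.End.mem_eigenspace_iff, Matrix.toLin'_apply] at hφE
  exact ⟨φ, hφE.1, hφ1, hφE.2, hφY⟩

/-- The crux at a FIXED coupling `U` (so that `U = 0` can be named): `∃ δ∈(0,½), κ>0, a>0, L₀, …`. -/
def LowEnergyRigidityAtCoupling (U : ℝ) : Prop :=
  ∃ δ ∈ Set.Ioo (0 : ℝ) (1 / 2), ∃ κ : ℝ, 0 < κ ∧ ∃ a : ℝ, 0 < a ∧ ∃ L₀ : ℕ,
    ∀ (L : ℕ) [NeZero L], L₀ ≤ L → Even L → RigidAt U δ κ a L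

/-- The crux by name is `∃ U > 0, LowEnergyRigidityAtCoupling U`. -/
theorem lowEnergyRigidity_iff_atCoupling :
    LowEnergyRigidity ↔ ∃ U : ℝ, 0 < U ∧ LowEnergyRigidityAtCoupling U := by
  constructor
  · rintro ⟨U, hU, δ, hδ, κ, hκ, a, ha, L₀, h⟩
    exact ⟨U, hU, δ, hδ, κ, hκ, a, ha, L₀, fun L _ hL hev => h L hL hev⟩
  · rintro ⟨U, hU, δ, hδ, κ, hκ, a, ha, L₀, h⟩
    exact ⟨U, hU, δ, hδ, κ, hκ, a, ha, L₀, fun L _ hL hev => h L hL hev⟩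

/-- **The repulsion is load-bearing: `¬ LowEnergyRigidityAtCoupling 0`.** At `U = 0` the matrix
fails for every `δ`, `κ`, `a`, `L₀`: at an even side `L ≥ max(L₀,3)` with `aL² > 32` the pair-poor
free ground state is a unit sector vector of energy `minEnergyOn` (inside the window) with LRO
density `≤ 32/L² < a`. Hence `0 < U` cannot be weakened to `0 ≤ U`, and no witness order `a` can be
chosen uniformly on a coupling range reaching `U = 0`. -/
theorem lowEnergyRigidity_false_without_repulsion : ¬ LowEnergyRigidityAtCoupling 0 := by
  rintro ⟨δ, hδ, κ, hκ, a, ha, L₀, h⟩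
  set M : ℕ := ⌈32 / a⌉₊ with hM
  set L : ℕ := 2 * (max L₀ M + 2) with hLdef
  have hL0 : L₀ ≤ L := by have := le_max_left L₀ M; omega
  have hLM : M + 1 ≤ L := by have := le_max_right L₀ M; omega
  have hL3 : 3 ≤ L := by omega
  haveI : NeZero L := ⟨by omega⟩
  have hev : Even L := even_two_mul _
  have hLreal : 32 / a < (L : ℝ) := by
    have h1 : 32 / a ≤ (M : ℝ) := Nat.le_ceil _
    have h2 : (M : ℝ) + 1 ≤ L := by exact_mod_cast hLM
    linarith
  have haL : 32 < a * (L : ℝ) ^ 2 := by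
    have h1 : 32 < a * L := by
      rw [div_lt_iff₀ ha] at hLreal; linarith
    have hL1 : (1 : ℝ) ≤ L := by exact_mod_cast (show 1 ≤ L by omega)
    nlinarith
  have hδ1 : (-1 : ℝ) ≤ δ := by linarith [hδ.1]
  obtain ⟨φ, hφS, hφ1, hφeig, hφY⟩ :=
    exists_unit_groundState_pairField_le_free L hL3 (natFloor_filling_le_sq hδ1 L)
  have hwin : (star φ ⬝ᵥ Matrix.mulVec (hubbardTorus 2 L 1 0) φ).re ≤
      (hubbardTorus 2 L 1 0).minEnergyOn (szSector (2 * ⌊(1 - δ) * (L : ℝ) ^ 2 / 2⌋₊) 0) + κ := by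
    rw [hφeig, dotProduct_smul, hφ1, smul_eq_mul, mul_one, Complex.ofReal_re]
    linarith
  have hLRO := h L hL0 hev φ hφS hφ1 hwin
  have hL4 : (0 : ℝ) < (L : ℝ) ^ 4 := by positivity
  simp only [Literature.MathematicalPhysics.QuantumLattice.expect] at hLRO
  rw [le_div_iff₀ hL4] at hLRO
  have : a * (L : ℝ) ^ 4 ≤ 32 * (L : ℝ) ^ 2 := hLRO.trans hφY
  nlinarith

/-! ### (c) No witness survives uniformly as `U → 0⁺` -/

/-- `H_U = H_0 + U Σ_x n_{x↑} n_{x↓}` on the torus. -/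
theorem hubbardTorus_eq_free_add_smul_doubleOcc (L : ℕ) [NeZero L] (U : ℝ) :
    hubbardTorus 2 L 1 U = hubbardTorus 2 L 1 0 +
      (U : ℂ) • ∑ x : FermionTorus 2 L, numberOp x 0 * numberOp x 1 := by
  have h := hamiltonianWith_sub_hamiltonianWith (fermionTorusGraph 2 L) 1 0 U 0
  rw [hamiltonianWith_zero, hamiltonianWith_zero, sub_zero] at h
  change hubbardTorus 2 L 1 U - hubbardTorus 2 L 1 0 = _ at h
  rw [sub_eq_iff_eq_add'] at h
  rw [h, add_comm]

section DoubleOccupancy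

variable {Λ : Type*} [LinearOrder Λ] [Fintype Λ]

/-- `Re⟨φ, Σ_x n_{x↑}n_{x↓} φ⟩ ≤ |Λ|` for a unit vector (operator bound `Σ_x n_{x↑}n_{x↓} ≤ |Λ|·1`;
generic `Λ` so that the `DecidableEq` hidden in `1` matches the Literature lemma). -/
theorem re_doubleOcc_le_card {φ : Fock (Orb Λ)} (hφ1 : star φ ⬝ᵥ φ = 1) :
    (star φ ⬝ᵥ (∑ x : Λ, numberOp x 0 * numberOp x 1) *ᵥ φ).re ≤ Fintype.card Λ := by
  have h := (posSemidef_card_sub_sum_numberOp_mul_numberOp (Λ := Λ)).re_dotProduct_nonneg φ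
  rw [sub_mulVec, dotProduct_sub, smul_mulVec, one_mulVec, dotProduct_smul, hφ1, smul_eq_mul,
    mul_one] at h
  simp only [RCLike.re_to_complex, Complex.sub_re, Complex.natCast_re] at h
  linarith

/-- `0 ≤ Re⟨φ, Σ_x n_{x↑}n_{x↓} φ⟩`. -/
theorem re_doubleOcc_nonneg (φ : Fock (Orb Λ)) :
    0 ≤ (star φ ⬝ᵥ (∑ x : Λ, numberOp x 0 * numberOp x 1) *ᵥ φ).re := by
  have h := (posSemidef_sum_numberOp_mul_numberOp (Λ := Λ)).re_dotProduct_nonneg φ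
  simpa only [RCLike.re_to_complex] using h

end DoubleOccupancy

/-- **Sector ground energies are non-decreasing in the repulsion** (`0 ≤ U`). -/
theorem minEnergyOn_free_le_minEnergyOn (L : ℕ) [NeZero L] {U : ℝ} (hU : 0 ≤ U)
    (K : Submodule ℂ (Fock (Orb (FermionTorus 2 L))))
    (hK : ∃ ψ ∈ K, star ψ ⬝ᵥ ψ = 1) :
    (hubbardTorus 2 L 1 0).minEnergyOn K ≤ (hubbardTorus 2 L 1 U).minEnergyOn K := by
  obtain ⟨ψ₀, hψ₀K, hψ₀⟩ := hK
  refine le_csInf ⟨_, ψ₀, hψ₀K, hψ₀, rfl⟩ ?_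
  rintro E ⟨ψ, hψK, hψ1, rfl⟩
  rw [hubbardTorus_eq_free_add_smul_doubleOcc L U, add_mulVec, dotProduct_add, Complex.add_re,
    smul_mulVec, dotProduct_smul, smul_eq_mul, Complex.re_ofReal_mul]
  have h1 := minEnergyOn_le_re_rayleigh (hubbardTorus 2 L 1 0) K hψK hψ1
  have h2 := mul_nonneg hU (re_doubleOcc_nonneg ψ)
  linarith

/-- The crux with `(δ, κ, a, L₀)` UNIFORM on a coupling range `(0, U₀)`. -/
def LowEnergyRigidityUniformNearZero : Prop :=
  ∃ δ ∈ Set.Ioo (0 : ℝ) (1 / 2), ∃ κ : ℝ, 0 < κ ∧ ∃ a : ℝ, 0 < a ∧ ∃ L₀ : ℕ, ∃ U₀ : ℝ, 0 < U₀ ∧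
    ∀ U ∈ Set.Ioo (0 : ℝ) U₀, ∀ (L : ℕ) [NeZero L], L₀ ≤ L → Even L → RigidAt U δ κ a L

/-- The uniform version implies the crux (take `U = U₀/2`). -/
theorem lowEnergyRigidity_of_uniformNearZero (h : LowEnergyRigidityUniformNearZero) :
    LowEnergyRigidity := by
  obtain ⟨δ, hδ, κ, hκ, a, ha, L₀, U₀, hU₀, h⟩ := h
  exact ⟨U₀ / 2, by positivity, δ, hδ, κ, hκ, a, ha, L₀,
    fun L _ hL hev => h (U₀ / 2) ⟨by positivity, by linarith⟩ L hL hev⟩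

/-- **No witness survives uniformly as `U → 0⁺`: `¬ LowEnergyRigidityUniformNearZero`.** At an
even side `L ≥ max(L₀,3)` with `aL² > 32` the pair-poor FREE ground state lies in the `κ`-window
of `H_U` for `U = min(U₀/2, κ/L²)` (`Re⟨φ,H_Uφ⟩ ≤ E₀(0) + UL² ≤ E₀(U) + κ`) with LRO `≤ 32/L² < a`.
So `(κ, a, L₀)(U)` must degenerate as `U → 0⁺`; `L₀(U)² > κ(U)/U` whenever `a(U) > 32/L₀(U)²`. -/
theorem not_lowEnergyRigidity_uniform_near_zero_coupling : ¬ LowEnergyRigidityUniformNearZero := by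
  rintro ⟨δ, hδ, κ, hκ, a, ha, L₀, U₀, hU₀, h⟩
  set M : ℕ := ⌈32 / a⌉₊ with hM
  set L : ℕ := 2 * (max L₀ M + 2) with hLdef
  have hL0 : L₀ ≤ L := by have := le_max_left L₀ M; omega
  have hLM : M + 1 ≤ L := by have := le_max_right L₀ M; omega
  have hL3 : 3 ≤ L := by omega
  haveI : NeZero L := ⟨by omega⟩
  have hev : Even L := even_two_mul _
  have hLreal : 32 / a < (L : ℝ) := by
    have h1 : 32 / a ≤ (M : ℝ) := Nat.le_ceil _
    have h2 : (M : ℝ) + 1 ≤ L := by exact_mod_cast hLM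
    linarith
  have hL1 : (1 : ℝ) ≤ L := by exact_mod_cast (show 1 ≤ L by omega)
  have haL : 32 < a * (L : ℝ) ^ 2 := by
    have h1 : 32 < a * L := by
      rw [div_lt_iff₀ ha] at hLreal; linarith
    nlinarith
  have hL2 : (0 : ℝ) < (L : ℝ) ^ 2 := by positivity
  have hδ1 : (-1 : ℝ) ≤ δ := by linarith [hδ.1]
  obtain ⟨φ, hφS, hφ1, hφeig, hφY⟩ :=
    exists_unit_groundState_pairField_le_free L hL3 (natFloor_filling_le_sq hδ1 L)
  set U : ℝ := min (U₀ / 2) (κ / (L : ℝ) ^ 2) with hUdef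
  have hUpos : 0 < U := lt_min (by positivity) (by positivity)
  have hUlt : U < U₀ := (min_le_left _ _).trans_lt (by linarith)
  have hUL : U * (L : ℝ) ^ 2 ≤ κ := by
    have := min_le_right (U₀ / 2) (κ / (L : ℝ) ^ 2)
    rw [← hUdef, le_div_iff₀ hL2] at this
    exact this
  set S := szSector (Λ := FermionTorus 2 L) (2 * ⌊(1 - δ) * (L : ℝ) ^ 2 / 2⌋₊) 0 with hSdef
  have hE0 : (star φ ⬝ᵥ (hubbardTorus 2 L 1 0) *ᵥ φ).re = (hubbardTorus 2 L 1 0).minEnergyOn S := by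
    rw [hφeig, dotProduct_smul, hφ1, smul_eq_mul, mul_one, Complex.ofReal_re]
  have hmono := minEnergyOn_free_le_minEnergyOn L hUpos.le S ⟨φ, hφS, hφ1⟩
  have hEU : (star φ ⬝ᵥ Matrix.mulVec (hubbardTorus 2 L 1 U) φ).re =
      (hubbardTorus 2 L 1 0).minEnergyOn S +
        U * (star φ ⬝ᵥ (∑ x : FermionTorus 2 L, numberOp x 0 * numberOp x 1) *ᵥ φ).re := by
    rw [hubbardTorus_eq_free_add_smul_doubleOcc L U, add_mulVec, dotProduct_add, Complex.add_re,
      smul_mulVec, dotProduct_smul, smul_eq_mul, Complex.re_ofReal_mul, hE0]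
  have hwin : (star φ ⬝ᵥ Matrix.mulVec (hubbardTorus 2 L 1 U) φ).re ≤
      (hubbardTorus 2 L 1 U).minEnergyOn S + κ := by
    rw [hEU]
    have hD := re_doubleOcc_le_card (Λ := FermionTorus 2 L) hφ1
    rw [card_fermionTorus 2] at hD
    push_cast at hD
    have : U * (star φ ⬝ᵥ (∑ x : FermionTorus 2 L, numberOp x 0 * numberOp x 1) *ᵥ φ).re ≤ κ :=
      (mul_le_mul_of_nonneg_left hD hUpos.le).trans hUL
    linarith
  have hLRO := h U ⟨hUpos, hUlt⟩ L hL0 hev φ hφS hφ1 hwin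
  have hL4 : (0 : ℝ) < (L : ℝ) ^ 4 := by positivity
  simp only [Literature.MathematicalPhysics.QuantumLattice.expect] at hLRO
  rw [le_div_iff₀ hL4] at hLRO
  have : a * (L : ℝ) ^ 4 ≤ 32 * (L : ℝ) ^ 2 := hLRO.trans hφY
  nlinarith

/-! ### (d) Saturated ferromagnets in the window kill the matrix -/

section Ferromagnet

open Literature.Probability.LatticeModels HubbardWave0
open Summit.HubbardSuperconductivity.HubbardSuperconductivity.Theorems.SsbToEvenTorusLro.Negative

/-- **A saturated ferromagnet inside the window kills `RigidAt`.** If at side `L` the fully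
polarised sector `(N_L, S^z = N_L/2)` comes within `κ` of the `(N_L, 0)` sector energy (`δ ≥ 0`),
then `¬ RigidAt U δ κ a L` for every `a > 0`: the `(S⁻)ⁿ`-descendant of a top-sector ground state
is a unit window state of `szSector N_L 0` annihilated by `Δ_d`. -/
theorem rigidAt_false_of_ferromagnet_in_window (L : ℕ) [NeZero L] {U δ κ a : ℝ} (hδ : 0 ≤ δ)
    (ha : 0 < a)
    (hFM : (hubbardTorus 2 L 1 U).minEnergyOn (szSector (2 * ⌊(1 - δ) * (L : ℝ) ^ 2 / 2⌋₊)
        (((2 * ⌊(1 - δ) * (L : ℝ) ^ 2 / 2⌋₊ : ℕ) : ℝ) / 2)) ≤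
      (hubbardTorus 2 L 1 U).minEnergyOn (szSector (2 * ⌊(1 - δ) * (L : ℝ) ^ 2 / 2⌋₊) 0) + κ) :
    ¬ RigidAt U δ κ a L := by
  intro h
  set n : ℕ := ⌊(1 - δ) * (L : ℝ) ^ 2 / 2⌋₊ with hndef
  have hn : 2 * n ≤ L ^ 2 := two_mul_natFloor_le_sq hδ L
  set H := hubbardTorus 2 L 1 U with hH
  obtain ⟨φ, -, hφ⟩ := exists_unit_isGroundStateInSector_top U L (2 * n) hn
  have hsec : IsInSector (2 * n) 0 φ := (mem_szSector_top_iff _ _).1 hφ.1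
  have hc : Commute H Literature.MathematicalPhysics.QuantumLattice.spinMinus :=
    LiebThm1.hamiltonian_commute_spinMinus (fermionTorusGraph 2 L) 1 U
  obtain ⟨w, hw, hw0, hHw, hSw⟩ := saturated_descendant H hc hsec hφ.2.1 hφ.2.2
  obtain ⟨c, hc0, hc1⟩ := exists_smul_unit hw0
  have hψS : c • w ∈ szSector (Λ := FermionTorus 2 L) (2 * n) 0 :=
    Submodule.smul_mem _ c ((mem_szSector_two_mul_zero_iff n w).2 hw)
  have hHψ : H *ᵥ (c • w) =
      (((hubbardTorus 2 L 1 U).minEnergyOn (szSector (2 * n) (((2 * n : ℕ) : ℝ) / 2)) : ℝ) : ℂ) •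
        (c • w) := by
    rw [mulVec_smul, hHw, smul_comm]
  have hwin : (star (c • w) ⬝ᵥ Matrix.mulVec (hubbardTorus 2 L 1 U) (c • w)).re ≤
      (hubbardTorus 2 L 1 U).minEnergyOn (szSector (2 * n) 0) + κ := by
    rw [← hH, hHψ, dotProduct_smul, hc1, smul_eq_mul, mul_one, Complex.ofReal_re]
    exact hFM
  have hLRO := h (c • w) hψS hc1 hwin
  have hN : IsNParticle (2 * n) (c • w) := ((mem_szSector_iff _ _ _).1 hψS).1
  have hS : spinSq *ᵥ (c • w) =
      ((((2 * n : ℕ) : ℝ) / 2 * ((((2 * n : ℕ) : ℝ) / 2) + 1) : ℝ) : ℂ) • (c • w) := by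
    rw [mulVec_smul, hSw, smul_comm]
    congr 2
    push_cast
    ring
  have hzero : pairField dWaveFormFactor L *ᵥ (c • w) = 0 :=
    Summit.HubbardSuperconductivity.NoGo.pairField_mulVec_eq_zero_of_saturated dWaveFormFactor L hN hS
  have hexp : expect ((pairField dWaveFormFactor L)ᴴ * pairField dWaveFormFactor L) (c • w) = 0 := by
    simp only [Literature.MathematicalPhysics.QuantumLattice.expect]
    rw [← mulVec_mulVec, hzero, mulVec_zero, dotProduct_zero]
  rw [hexp, Complex.zero_re, zero_div] at hLRO
  exact absurd hLRO (not_le.2 ha)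

/-- **Witnesses exclude ferromagnetism from their window.** If at `(U, δ, κ)`, `δ ∈ (0,½)`, the
saturated ferromagnet enters the `κ`-window at infinitely many even sides, then
`¬ LowEnergyRigidityWith κ a` is witnessed at that `(U, δ)` for every `a`; stated as: no `a > 0`,
`L₀` complete `(U, δ, κ)`. -/
theorem not_completable_of_frequently_ferromagnet {U δ κ : ℝ} (hδ : 0 ≤ δ)
    (hFM : ∀ L₀ : ℕ, ∃ L : ℕ, L₀ ≤ L ∧ Even L ∧
      (hubbardTorus 2 L 1 U).minEnergyOn (szSector (2 * ⌊(1 - δ) * (L : ℝ) ^ 2 / 2⌋₊)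
          (((2 * ⌊(1 - δ) * (L : ℝ) ^ 2 / 2⌋₊ : ℕ) : ℝ) / 2)) ≤
        (hubbardTorus 2 L 1 U).minEnergyOn (szSector (2 * ⌊(1 - δ) * (L : ℝ) ^ 2 / 2⌋₊) 0) + κ) :
    ¬ ∃ a : ℝ, 0 < a ∧ ∃ L₀ : ℕ, ∀ (L : ℕ) [NeZero L], L₀ ≤ L → Even L → RigidAt U δ κ a L := by
  rintro ⟨a, ha, L₀, h⟩
  obtain ⟨L, hL, hev, hwin⟩ := hFM (L₀ + 1)
  haveI : NeZero L := ⟨by omega⟩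
  exact rigidAt_false_of_ferromagnet_in_window L hδ ha hwin (h L (by omega) hev)

end Ferromagnet

end

end Summit.HubbardSuperconductivity.HubbardSuperconductivity.Cruxes.LowEnergyRigidity.Disproof
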